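/- Free-seat work of LEAD seat `ym-line-cbag-p1` (prover-ym-line-cbag-p1-g22-0; own crux stmt-QuantumFields-22254 closed) on the
planner-of-record's LINE 7, route `GlueballBandRecursion`: the rev-1 glue `Assembly2` (stmt-QuantumFields-27555). -/
import Summits.QuantumFields.YangMills.Theses.GlueballBandRecursion
import Summits.QuantumFields.YangMills.Theorems.GlueballBandRecursionColdDoublingEnginePointwise

/-!
# Route `GlueballBandRecursion`, glue rev 1 `Assembly2` (stmt-QuantumFields-27555):
`GapStableUnderRefinement → ThermalMultiplicityUpper → OneGlueballBandDichotomy → ColdDoublingRecursionStrongCoupling` — PROVED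

The route's deciding implication after the critic's price P1 (idea-crit-4, 2026-08-28T10:49Z; planner ym-idea-2 g5 rev 1/2,
11:07Z): the band crux is now the per-`β` DICHOTOMY `OneGlueballBandDichotomy` (stmt-QuantumFields-27554) — at each `β` on the
strong-coupling window either the one-glueball BAND floor `a·N^{3/2}·q_N^t ≤ x_t(N)` holds for all `N ≥ L₀`, or the bottom excited
level is ISOLATED, `x_t(N) ≤ A′·q_N^t` for all `N ≥ L₀`.  Per `(G, r)`: constants `D` (K1), `A` (K2), `a, A′` (dichotomy); the
pointwise engine (`GlueballBandRecursionColdDoublingEnginePointwise.lean`) gives ONE threshold for each branch, and at each `β`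
the branch in force yields `δᶜ(L') ≤ C₁·δᶜ(L)²` (`C₁ = 512·A·e^{D}/a²`, the proved `Assembly` algebra) resp.
`δᶜ(L') ≤ C₂·δᶜ(L)²` (`C₂ = 8·A′·e^{D}`); `C = max C₁ C₂`, `L₀ = max` of the two thresholds.

HONEST FRAMING.  Only the implication is proved; K1 `GapStableUnderRefinement`, K2 `ThermalMultiplicityUpper` and the dichotomy
`OneGlueballBandDichotomy` are the route's OPEN cruxes, and the conclusion is the strong-coupling RUNG
`ColdDoublingRecursionStrongCoupling` of the IR cell (window `0 ≤ β ≤ strongCouplingRadius ρ`, group-blind) — a RECORD-type rung.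
Nothing here bears on weak coupling, the continuum, or the Yang–Mills mass gap (Clay), which is NOT proved by anything in this file.
-/

set_option autoImplicit false

noncomputable section

open Literature.MathematicalPhysics.QuantumFieldTheory
open Literature.MathematicalPhysics.QuantumFieldTheory.Balaban1983to89.Missing (strongCouplingRadius)
open Summit.QuantumFields.YangMills.Cruxes.IR.ColdPurityBridge (coldDefect ColdDoublingRecursionStrongCoupling)

namespace Summit.QuantumFields.YangMills.Theorems.GlueballBandRecursion

/-- **Glue rev 1 of route `GlueballBandRecursion` (stmt-QuantumFields-27555)**:
`GapStableUnderRefinement → ThermalMultiplicityUpper → OneGlueballBandDichotomy → ColdDoublingRecursionStrongCoupling`, with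
`C = max (512·A·e^{D}/a²) (8·A′·e^{D})` and `L₀` the max of the two pointwise-engine thresholds; at each `β` the dichotomy's branch
selects the engine (`coldDoublingRecursion_pointwise_of_band` / `coldDoublingRecursion_pointwise_of_isolated`).  Only the implication
is proved; no crux and no mass gap is claimed. -/
theorem assembly2_proof : Summit.QuantumFields.YangMills.Theses.GlueballBandRecursion.Assembly2 := by
  intro h₁ h₂ h₃ G _ _ _ _
  letI : MeasurableSpace G := borel G
  haveI : BorelSpace G := ⟨rfl⟩
  show ∀ r : LatticeRep G, ∃ C : ℝ, 0 < C ∧ ∃ L₀ : ℕ, ∀ β : ℝ, 0 ≤ β → β ≤ strongCouplingRadius r.ρ →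
      ∀ L : ℕ, L₀ ≤ L → ∀ L' : ℕ, 2 * L ≤ L' → L' ≤ 4 * L →
        coldDefect r.ρ β L' ≤ C * coldDefect r.ρ β L ^ 2
  intro r
  -- the three cruxes at `(G, r)`
  have hK1' : ∃ D : ℝ, 0 ≤ D ∧ ∃ L₀ : ℕ, ∀ β : ℝ, 0 ≤ β → β ≤ strongCouplingRadius r.ρ →
      ∀ (L : ℕ) [NeZero L] (L' : ℕ) [NeZero L'], L₀ ≤ L → 2 * L ≤ L' → L' ≤ 4 * L →
        (⨅ k : ℕ, traceExcess r.ρ β L' (k + 2) ^ ((1 : ℝ) / ((k : ℝ) + 2))) ≤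
          Real.exp (D / (L : ℝ)) * (⨅ k : ℕ, traceExcess r.ρ β L (k + 2) ^ ((1 : ℝ) / ((k : ℝ) + 2))) :=
    h₁ G r
  have hK2' : ∃ A : ℝ, 0 < A ∧ ∃ L₀ : ℕ, ∀ β : ℝ, 0 ≤ β → β ≤ strongCouplingRadius r.ρ →
      ∀ (N : ℕ) [NeZero N] (m : ℕ), N / 4 = m + 2 → L₀ ≤ N →
        traceExcess r.ρ β N (m + 2) ≤ A * (N : ℝ) ^ 3 *
          (⨅ k : ℕ, traceExcess r.ρ β N (k + 2) ^ ((1 : ℝ) / ((k : ℝ) + 2))) ^ (m + 2) :=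
    h₂ G r
  have hK3' : ∃ a : ℝ, 0 < a ∧ ∃ A' : ℝ, 0 < A' ∧ ∃ L₀ : ℕ, ∀ β : ℝ, 0 ≤ β → β ≤ strongCouplingRadius r.ρ →
      (∀ (N : ℕ) [NeZero N] (m : ℕ), N / 4 = m + 2 → L₀ ≤ N →
        a * Real.sqrt (N : ℝ) ^ 3 *
            (⨅ k : ℕ, traceExcess r.ρ β N (k + 2) ^ ((1 : ℝ) / ((k : ℝ) + 2))) ^ (m + 2) ≤
          traceExcess r.ρ β N (m + 2)) ∨
      (∀ (N : ℕ) [NeZero N] (m : ℕ), N / 4 = m + 2 → L₀ ≤ N →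
        traceExcess r.ρ β N (m + 2) ≤
          A' * (⨅ k : ℕ, traceExcess r.ρ β N (k + 2) ^ ((1 : ℝ) / ((k : ℝ) + 2))) ^ (m + 2)) :=
    h₃ G r
  obtain ⟨D, hD0, L₁, hK1⟩ := hK1'
  obtain ⟨A, hA0, L₂, hK2⟩ := hK2'
  obtain ⟨a, ha0, A', hA'0, L₃, hK3⟩ := hK3'
  -- one threshold per branch, chosen before `β`
  obtain ⟨M₁, hM₁⟩ := coldDoublingRecursion_pointwise_of_band r hD0 hA0 ha0 L₁ L₂ L₃
  obtain ⟨M₂, hM₂⟩ := coldDoublingRecursion_pointwise_of_isolated r hD0 hA'0 L₁ L₃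
  refine ⟨max (512 * A * Real.exp D / a ^ 2) (8 * A' * Real.exp D),
    lt_max_of_lt_left (by positivity), max M₁ M₂, ?_⟩
  intro β hβ0 hβ L hL L' hLL' hL'L
  have hδ2 : 0 ≤ coldDefect r.ρ β L ^ 2 := sq_nonneg _
  rcases hK3 β hβ0 hβ with hband | hiso
  · -- band at this `β`: the proved `Assembly` algebra
    have h := hM₁ β hβ0 hβ (hK1 β hβ0 hβ) (hK2 β hβ0 hβ) hband L (le_trans (le_max_left _ _) hL) L' hLL' hL'L
    exact h.trans (mul_le_mul_of_nonneg_right (le_max_left _ _) hδ2)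
  · -- isolated at this `β`: the critic's branch 2
    have h := hM₂ β hβ0 hβ (hK1 β hβ0 hβ) hiso L (le_trans (le_max_right _ _) hL) L' hLL' hL'L
    exact h.trans (mul_le_mul_of_nonneg_right (le_max_right _ _) hδ2)

end Summit.QuantumFields.YangMills.Theorems.GlueballBandRecursion

end
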